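import Literature.Topology.FourManifolds.GaussDiagrams
import HarnessLib

/-!
# Reversing a knot reverses its Gauss diagrams (discharge of `Knot.HasGaussDiagram.reverse`)

Second sibling proof file of `GaussDiagrams.lean` (next to `GaussDiagramsProofs.lean`, which
discharges `unknot_hasGaussDiagram_empty`; D-0014: named facts `def X : Prop` are discharged as
`theorem X_holds : X`). It proves the named fact
`Literature.Topology.FourManifolds.Knot.HasGaussDiagram.reverse`:
`Knot.HasGaussDiagram.reverse_holds`.

M. Goussarov, M. Polyak, O. Viro, *Finite-type invariants of classical and virtual knots*,
Topology 39 (2000) 1045–1068, §1.1 (arXiv:math/9810073, §1.1 "Diagrams and Gauss diagrams"):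
the Gauss diagram of a knot diagram is the parametrising (oriented) circle together with the
two preimages of each double point joined by a chord, the chord oriented from the over-passage
to the under-passage and decorated with the local writhe of the crossing. Reversing the
orientation of the knot therefore reverses the cyclic order of the `2n` marked points and
changes nothing else (arrows and local writhes do not see the orientation of the circle: both
tangent vectors at a crossing change sign, so `det (γ'(over), γ'(under))` is unchanged); this is
`GaussDiagram.reverse` (positions renumbered by `Fin.rev`). D. Rolfsen, *Knots and Links*
(1976), §3.C, for the reverse of a knot.

The proof is the corresponding bookkeeping on `Knot.RegularProjection`: `K.reverse` is
`K ∘ reflectLast 1`, and `reflectLast 1 (cos t, sin t) = (cos (-t), sin (-t))`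
(`circlePoint_neg_eq_reflectLast`; the same computation as `reflectLast_circlePoint` of
`KirbyMovesReverseProofs`, which is not imported here to keep the import cone small), so the
plane curve and the height function of `K.reverse` are those of `K` run backwards
(`Knot.planeCurve_reverse_apply`, `Knot.heightCurve_reverse_apply`), with
velocity `-γ' (-t)` (`Knot.deriv_planeCurve_reverse`, Mathlib's `deriv_comp_neg`, no
differentiability needed). Given a regular projection `P` of `K`, the parameters
`q ↦ -θ (Fin.rev q)` then satisfy every axiom of a regular projection of `K.reverse` with diagram
`P.diagram.reverse` (`Knot.RegularProjection.hasGaussDiagram_reverse`).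

Nothing here is new mathematics; no definitions and no named facts are introduced.

## References

* M. Goussarov, M. Polyak, O. Viro, *Finite-type invariants of classical and virtual knots*,
  Topology 39 (2000) 1045–1068, §1.1; arXiv:math/9810073.
* D. Rolfsen, *Knots and Links*, Publish or Perish (1976), §3.C.
-/

open scoped Manifold ContDiff Topology
open Function Set

noncomputable section

namespace Literature.Topology.FourManifolds

/-- Running the standard parametrisation of `𝕊 1` backwards is reflecting the circle in its
last coordinate: `(cos (-t), sin (-t)) = (cos t, -sin t) = reflectLast 1 (cos t, sin t)`. (The same
computation as `reflectLast_circlePoint` of `KirbyMovesReverseProofs`, not imported here.)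
[folklore] -/
theorem circlePoint_neg_eq_reflectLast (t : ℝ) :
    circlePoint (-t) = reflectLast 1 (circlePoint t) := by
  apply Subtype.ext
  ext i
  fin_cases i
  · rw [reflectLast_apply_of_ne_last 1 _ (by decide)]
    simp [Real.cos_neg]
  · rw [show ((⟨1, by norm_num⟩ : Fin 2)) = Fin.last 1 from rfl, reflectLast_apply_last]
    simp [Real.sin_neg, show (Fin.last 1 : Fin 2) = 1 from rfl]

namespace GaussDiagram

/-- Reversal keeps the number of chords. [folklore] -/
theorem reverse_n (G : GaussDiagram) : G.reverse.n = G.n := rfl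

/-- Reversal moves the over-passage at position `q` to position `Fin.rev q = 2n - 1 - q`. [folklore] -/
theorem reverse_overPos (G : GaussDiagram) (i : Fin G.n) :
    G.reverse.overPos i = Fin.rev (G.overPos i) := rfl

/-- Reversal moves the under-passage at position `q` to position `Fin.rev q = 2n - 1 - q`.
[folklore] -/
theorem reverse_underPos (G : GaussDiagram) (i : Fin G.n) :
    G.reverse.underPos i = Fin.rev (G.underPos i) := rfl

/-- Reversal keeps the signs (local writhes). [folklore] -/
theorem reverse_sign_apply (G : GaussDiagram) (i : Fin G.n) : G.reverse.sign i = G.sign i := rfl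

/-- `Fin.rev` undoes the reversal on over-passages. [folklore] -/
theorem rev_reverse_overPos (G : GaussDiagram) (i : Fin G.n) :
    Fin.rev (G.reverse.overPos i) = G.overPos i :=
  Fin.rev_rev _

/-- `Fin.rev` undoes the reversal on under-passages. [folklore] -/
theorem rev_reverse_underPos (G : GaussDiagram) (i : Fin G.n) :
    Fin.rev (G.reverse.underPos i) = G.underPos i :=
  Fin.rev_rev _

end GaussDiagram

namespace Knot

/-- The plane curve of the reversed knot is the plane curve run backwards:
`K.reverse (cos t, sin t) = K (cos (-t), sin (-t))` (cf. `Knot.reverse_apply_circlePoint` of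
`LinkingNumberReverseProofs`, not imported here), then project. [folklore] -/
theorem planeCurve_reverse_apply [SphereEmbedding.SmoothnessFacts] (K : Knot) (t : ℝ) :
    K.reverse.planeCurve t = K.planeCurve (-t) := by
  rw [planeCurve, planeCurve, circlePoint_neg_eq_reflectLast]
  rfl

/-- The height function of the reversed knot is the height function run backwards. [folklore] -/
theorem heightCurve_reverse_apply [SphereEmbedding.SmoothnessFacts] (K : Knot) (t : ℝ) :
    K.reverse.heightCurve t = K.heightCurve (-t) := by
  rw [heightCurve, heightCurve, circlePoint_neg_eq_reflectLast]
  rfl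

/-- The velocity of the reversed plane curve: `(γ ∘ (t ↦ -t))' (t) = -γ' (-t)` (valid without
any differentiability hypothesis, Mathlib's `deriv_comp_neg`). [folklore] -/
theorem deriv_planeCurve_reverse [SphereEmbedding.SmoothnessFacts] (K : Knot) (t : ℝ) :
    deriv K.reverse.planeCurve t = -deriv K.planeCurve (-t) := by
  rw [show K.reverse.planeCurve = fun s ↦ K.planeCurve (-s) from
    funext (planeCurve_reverse_apply K)]
  exact deriv_comp_neg K.planeCurve t

namespace RegularProjection

variable {K : Knot} (P : K.RegularProjection)

/-- Reading the old parameters backwards: at the over-passage of chord `i` of the reversed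
diagram (position `Fin.rev (overPos i)`) one finds the old parameter `θ (overPos i)`. [folklore] -/
theorem θ_rev_reverse_overPos (i : Fin P.diagram.n) :
    P.θ (Fin.rev (P.diagram.reverse.overPos i)) = P.θ (P.diagram.overPos i) :=
  congrArg P.θ (P.diagram.rev_reverse_overPos i)

/-- Reading the old parameters backwards: at the under-passage of chord `i` of the reversed
diagram (position `Fin.rev (underPos i)`) one finds the old parameter `θ (underPos i)`. [folklore] -/
theorem θ_rev_reverse_underPos (i : Fin P.diagram.n) :
    P.θ (Fin.rev (P.diagram.reverse.underPos i)) = P.θ (P.diagram.underPos i) :=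
  congrArg P.θ (P.diagram.rev_reverse_underPos i)

/-- **The reversed regular projection.** If `P` is a regular projection of `K` reading the Gauss
diagram `P.diagram`, then the same plane curve run backwards, with parameters
`q ↦ -θ (Fin.rev q)` at the `2n` positions, is a regular projection of `K.reverse` reading
`P.diagram.reverse`: double points and heights are met at the negated parameters, and the
determinants `det (γ'(over), γ'(under))` have both rows negated, hence are unchanged, so the
signs agree. GPV (2000), §1.1; Rolfsen (1976), §3.C. [cite: GPV2000, §1.1] -/
theorem hasGaussDiagram_reverse [SphereEmbedding.SmoothnessFacts] :
    K.reverse.HasGaussDiagram P.diagram.reverse := by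
  refine ⟨{ diagram := P.diagram.reverse
            θ := fun q ↦ -P.θ (Fin.rev q)
            strictMono := fun _ _ hab ↦ neg_lt_neg (P.strictMono (Fin.rev_lt_rev.2 hab))
            lt_add_two_pi := fun i j ↦ ?_
            northPole_notMem := ?_
            deriv_ne_zero := fun t ↦ ?_
            double := fun i ↦ ?_
            eq_or_crossing := fun s t hst ↦ ?_
            heightCurve_lt := fun i ↦ ?_
            sign_eq := fun i ↦ ?_ }, rfl⟩
  · -- one period
    have := P.lt_add_two_pi (Fin.rev j) (Fin.rev i)
    show -P.θ (Fin.rev i) < -P.θ (Fin.rev j) + 2 * Real.pi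
    linarith
  · -- the reversed knot has the same image
    rintro ⟨x, hx⟩
    exact P.northPole_notMem ⟨reflectLast 1 x, hx⟩
  · -- immersion
    rw [deriv_planeCurve_reverse, neg_ne_zero]
    exact P.deriv_ne_zero (-t)
  · -- double points
    show K.reverse.planeCurve (-P.θ (Fin.rev (P.diagram.reverse.overPos i))) =
      K.reverse.planeCurve (-P.θ (Fin.rev (P.diagram.reverse.underPos i)))
    rw [θ_rev_reverse_overPos, θ_rev_reverse_underPos, planeCurve_reverse_apply,
      planeCurve_reverse_apply, neg_neg, neg_neg]
    exact P.double i
  · -- no other multiple points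
    show (∃ k : ℤ, t = s + k * (2 * Real.pi)) ∨
      ∃ (i : Fin P.diagram.n) (k l : ℤ), ({s + k * (2 * Real.pi), t + l * (2 * Real.pi)} : Set ℝ)
        = {-P.θ (Fin.rev (P.diagram.reverse.overPos i)), -P.θ (Fin.rev (P.diagram.reverse.underPos i))}
    rw [planeCurve_reverse_apply, planeCurve_reverse_apply] at hst
    rcases P.eq_or_crossing (-s) (-t) hst with ⟨k, hk⟩ | ⟨i, k, l, h⟩
    · exact .inl ⟨-k, by push_cast; linarith⟩
    · refine .inr ⟨i, -k, -l, ?_⟩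
      rw [θ_rev_reverse_overPos, θ_rev_reverse_underPos]
      rw [pair_eq_pair_iff] at h ⊢
      push_cast
      rcases h with ⟨h1, h2⟩ | ⟨h1, h2⟩
      · exact .inl ⟨by linarith, by linarith⟩
      · exact .inr ⟨by linarith, by linarith⟩
  · -- heights
    show K.reverse.heightCurve (-P.θ (Fin.rev (P.diagram.reverse.underPos i))) <
      K.reverse.heightCurve (-P.θ (Fin.rev (P.diagram.reverse.overPos i)))
    rw [θ_rev_reverse_overPos, θ_rev_reverse_underPos, heightCurve_reverse_apply,
      heightCurve_reverse_apply, neg_neg, neg_neg]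
    exact P.heightCurve_lt i
  · -- signs: both rows of the determinant are negated
    show ((P.diagram.reverse.sign i : ℤˣ) : ℤ) = SignType.sign (Matrix.det
      !![(deriv K.reverse.planeCurve (-P.θ (Fin.rev (P.diagram.reverse.overPos i)))).1,
          (deriv K.reverse.planeCurve (-P.θ (Fin.rev (P.diagram.reverse.overPos i)))).2;
         (deriv K.reverse.planeCurve (-P.θ (Fin.rev (P.diagram.reverse.underPos i)))).1,
          (deriv K.reverse.planeCurve (-P.θ (Fin.rev (P.diagram.reverse.underPos i)))).2])
    rw [θ_rev_reverse_overPos, θ_rev_reverse_underPos, deriv_planeCurve_reverse,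
      deriv_planeCurve_reverse, neg_neg, neg_neg, P.diagram.reverse_sign_apply, P.sign_eq i,
      Matrix.det_fin_two_of, Matrix.det_fin_two_of]
    simp only [Prod.fst_neg, Prod.snd_neg, neg_mul_neg]

end RegularProjection

/-- **Discharge of `Knot.HasGaussDiagram.reverse`.** Reversing a knot reverses its Gauss
diagrams: a regular projection `P` of `K` reading `G` gives a regular projection of
`K.reverse` (the same plane curve run backwards, `t ↦ -t`, positions renumbered by `Fin.rev`)
reading `G.reverse` (`Knot.RegularProjection.hasGaussDiagram_reverse`).
Goussarov–Polyak–Viro, *Finite-type invariants of classical and virtual knots*, Topology 39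
(2000), §1.1 (arXiv:math/9810073, §1.1: the Gauss diagram is read along the oriented circle,
chords oriented over → under, signs = local writhes); Rolfsen (1976), §3.C (reverse of a
knot). [cite: GPV2000, §1.1] -/
theorem HasGaussDiagram.reverse_holds : HasGaussDiagram.reverse := by
  rintro _ K G ⟨P, rfl⟩
  exact P.hasGaussDiagram_reverse

end Knot

end Literature.Topology.FourManifolds
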